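import Mathlib
import HarnessLib
import Summits.Ventures.LatticeQCDFlow.Exactness.FlowPushforward
import Summits.Ventures.LatticeQCDFlow.Exactness.U1MaskedLayerCircleMap

/-!
# A certified `HasJacobian` for a gauge-field layer: the masked U(1) layer on the circle `ℝ/2πℤ`, link by link and against any frozen environment

HONEST FRAMING: exact (Metropolis-corrected) sampling algorithms for lattice gauge theory;
figures of merit are autocorrelation/cost numbers at stated couplings and volumes; no
continuum-physics claim.

Venture `LatticeQCDFlow` (cell pub-lqcd), topic `Exactness`; FANOUT row 14 (`eng-flowhmc`, the
field-transformation HMC engine `latflow.fthmc`, family B).  NEW WORK of the cell over Mathlib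
(Haar measure and fundamental-domain integrals on `AddCircle`, Tonelli, uniqueness of finite Borel
measures from bounded continuous test functions) and the tree's `Exactness/FlowPushforward.lean`
(`HasJacobian vol F J :⇔ F_*(J · vol) = vol`, the exactness interface of every flow / field-
transformation theorem of the cell: `flow_reweighting_exact`, `wilson_flow_reweighting_exact`,
`TransformedKernel.thmc_exact`, `TransformedHMC.thmc_hmc_exact`) and
`Exactness/U1MaskedLayerCircleMap.lean` (row 14: the single-link map `Φ(θ) = θ + Σ_j c_j sin(α_j − θ)`
is a degree-one bijection with `∫_a^{a+2π} g(Φ θ)(1 − C(θ)) dθ = ∫_a^{a+2π} g` whenever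
`Σ_j |c_j| < 1`).  Nothing is cited as a fact.  Printed counterparts, named only: Lüscher 2010;
Kanwar et al. 2020; Jin 2022 / He–Jin–Osborn–Zhao 2025.

`FlowPushforward.lean` records (docstring of `wilson_flow_reweighting_exact`) that certifying
`HasJacobian` for the gauge-equivariant layers "needs the Haar volume form on the Lie group (not in
Mathlib)".  For the ABELIAN group it is in Mathlib: `U(1) = AddCircle (2π)` carries its Haar measure
`volume` with the fundamental-domain formula `∫⁻_{(t, t+2π]} f ↑a da = ∫⁻ f`.  This file certifies the
hypothesis for the engine's U(1) layers (`maps.u1_wilson_flow_lo`, `maps.u1_residual`, twin `ref_u1`):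

* `HasJacobian.skewProd` (abstract, any measurable spaces): if for every value `p` of the PASSIVE
  data the active update `G p : X → X` has Jacobian `J p` w.r.t. `μ`, and `G`, `J` are jointly
  measurable, then the triangular map `(x, p) ↦ (G p x, p)` has Jacobian `(x, p) ↦ J p x` w.r.t.
  `μ ⊗ ν` for ANY s-finite law `ν` of the passive data (Tonelli + the fibrewise identity).  This is
  the measure-theoretic form of "a masked layer's log-det is the sum over active links".
* `hasJacobian_u1Layer_circle` — ONE LINK: for coefficients with `Σ_j |c_j| < 1`, any map `F` of the
  circle with `F ↑θ = ↑(θ + Σ_j c_j sin(α_j − θ))` and any `J` with `J ↑θ = 1 − Σ_j c_j cos(α_j − θ)`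
  (as `ℝ≥0∞`) satisfy `HasJacobian volume F J` — the Haar measure of the link pushed through the
  layer map weighted by the engine's Jacobian factor is the Haar measure.  (`F`, `J` are determined
  by these values; `exists_u1Layer_circle` builds them with `Function.Periodic.lift`, so the
  hypotheses are not vacuous.)  Proof: measurability through the measurable section
  `AddCircle.measurableEquivIco`; the identity on bounded continuous test functions is
  `integral_comp_u1Layer_period` transported by `AddCircle.lintegral_preimage`, and finite Borel
  measures on the (metrisable, compact) circle are determined by those integrals.
* `hasJacobian_u1Layer_env` — ONE ACTIVE LINK AGAINST ANY FROZEN ENVIRONMENT: for measurable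
  coefficient / angle maps `p ↦ c(p), α(p)` on any measurable space of passive data with s-finite
  law `ν` and `Σ_j |c_j(p)| < 1` for all `p`, the update `(θ, p) ↦ (Φ_{c(p),α(p)} θ, p)` has Jacobian
  `1 − C_{c(p),α(p)}(θ)` w.r.t. `Haar ⊗ ν`.  In the engine the passive data are the other links
  (the staple angles `α` and, for CNN-conditioned members, the coefficients `c` are functions of
  them) and `ν` is any s-finite measure — in particular the product Haar measure of the passive
  links, so that `Haar ⊗ ν` is the product Haar measure of the gauge field up to the coordinate
  split `MeasurableEquiv.piEquivPiSubtypeProd`; a layer with several active links is the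
  composition of such updates (masking: an active link never enters another's environment), and
  `HasJacobian.comp` multiplies the factors.

NOT here: the bookkeeping that re-assembles `(active link) × (passive links)` into `Edge → U(1)`
and composes the links of a layer and the layers of a member (`HasJacobian.comp`,
`measurePreserving_piEquivPiSubtypeProd` — no new mathematics); SU(N).
-/

noncomputable section

namespace Summit.Ventures.LatticeQCDFlow.Exactness

open Real Set Filter Function MeasureTheory
open scoped Topology NNReal ENNReal

/-! ## Skew products: fibrewise Jacobians assemble (Tonelli) -/

/-- **Triangular maps.**  If every fibre map `G p` has Jacobian `J p` w.r.t. `μ` and `G`, `J` are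
jointly measurable, then `(x, p) ↦ (G p x, p)` has Jacobian `(x, p) ↦ J p x` w.r.t. `μ ⊗ ν`. -/
theorem HasJacobian.skewProd {X P : Type*} [MeasurableSpace X] [MeasurableSpace P]
    {μ : Measure X} {ν : Measure P} [SFinite μ] [SFinite ν] {G : P → X → X} {J : P → X → ℝ≥0∞}
    (hG : Measurable fun z : X × P => G z.2 z.1) (hJ : Measurable fun z : X × P => J z.2 z.1)
    (h : ∀ p, HasJacobian μ (G p) (J p)) :
    HasJacobian (μ.prod ν) (fun z : X × P => (G z.2 z.1, z.2)) fun z => J z.2 z.1 := by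
  have hF : Measurable fun z : X × P => (G z.2 z.1, z.2) := hG.prodMk measurable_snd
  refine ⟨hF, hJ, ?_⟩
  ext s hs
  rw [Measure.map_apply hF hs, withDensity_apply _ (hF hs), ← lintegral_indicator (hF hs),
    lintegral_prod_symm _ (hJ.indicator (hF hs)).aemeasurable, Measure.prod_apply_symm hs]
  refine lintegral_congr fun p => ?_
  have hGp : Measurable (G p) := (h p).measurable
  have hSp : MeasurableSet ((fun x : X => (x, p)) ⁻¹' s) := measurable_prodMk_right hs
  have hind : ∀ x, ((fun z : X × P => (G z.2 z.1, z.2)) ⁻¹' s).indicator (fun z : X × P => J z.2 z.1)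
      (x, p) = ((G p) ⁻¹' ((fun x : X => (x, p)) ⁻¹' s)).indicator (J p) x := fun _ => rfl
  simp_rw [hind]
  rw [lintegral_indicator (hGp hSp), ← withDensity_apply _ (hGp hSp), ← Measure.map_apply hGp hSp,
    (h p).map_eq]

/-! ## The circle `U(1) = ℝ/2πℤ`: measurability through representatives -/

section Circle

variable {n : ℕ} (c α : Fin n → ℝ)

/-- The representative formula `θ ↦ ↑(Φ θ)` is a measurable map `ℝ → ℝ/2πℤ` … -/
theorem measurable_coe_u1Layer :
    Measurable fun θ : ℝ => ((θ + ∑ j, c j * sin (α j - θ) : ℝ) : AddCircle (2 * π)) :=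
  AddCircle.measurable_mk'.comp (continuous_u1Layer c α).measurable

/-- … and `θ ↦ 1 − C(θ)` is continuous. -/
theorem continuous_u1LayerJac : Continuous fun θ : ℝ => 1 - ∑ j, c j * cos (α j - θ) :=
  continuous_const.sub (continuous_finsetSum _ fun _ _ =>
    continuous_const.mul (continuous_cos.comp (continuous_const.sub continuous_id)))

/-- **Not vacuous**: the single-link layer map and its Jacobian factor DESCEND to the circle
(degree one / `2π`-periodicity), via `Function.Periodic.lift`. -/
theorem exists_u1Layer_circle :
    ∃ (F : AddCircle (2 * π) → AddCircle (2 * π)) (J : AddCircle (2 * π) → ℝ≥0∞),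
      (∀ θ : ℝ, F θ = ((θ + ∑ j, c j * sin (α j - θ) : ℝ) : AddCircle (2 * π))) ∧
      (∀ θ : ℝ, J θ = ENNReal.ofReal (1 - ∑ j, c j * cos (α j - θ))) := by
  have hF : Function.Periodic
      (fun θ : ℝ => ((θ + ∑ j, c j * sin (α j - θ) : ℝ) : AddCircle (2 * π))) (2 * π) := by
    intro θ
    simp only
    rw [u1Layer_add_two_pi c α θ, AddCircle.coe_add_period]
  have hJ : Function.Periodic
      (fun θ : ℝ => ENNReal.ofReal (1 - ∑ j, c j * cos (α j - θ))) (2 * π) := by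
    intro θ
    have h : ∀ j, cos (α j - (θ + 2 * π)) = cos (α j - θ) := fun j => by
      rw [sub_add_eq_sub_sub, cos_sub_two_pi]
    simp only [h]
  exact ⟨hF.lift, hJ.lift, fun θ => hF.lift_coe θ, fun θ => hJ.lift_coe θ⟩

/-- **Not vacuous** (environment version): a family of such lifts, one per environment `p`. -/
theorem exists_u1Layer_env {P : Type*} (cₚ αₚ : P → Fin n → ℝ) :
    ∃ (F : P → AddCircle (2 * π) → AddCircle (2 * π)) (J : P → AddCircle (2 * π) → ℝ≥0∞),
      (∀ p (θ : ℝ), F p θ = ((θ + ∑ j, cₚ p j * sin (αₚ p j - θ) : ℝ) : AddCircle (2 * π))) ∧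
      (∀ p (θ : ℝ), J p θ = ENNReal.ofReal (1 - ∑ j, cₚ p j * cos (αₚ p j - θ))) := by
  choose F J hF hJ using fun p => exists_u1Layer_circle (cₚ p) (αₚ p)
  exact ⟨F, J, hF, hJ⟩

variable [hT : Fact (0 < 2 * π)]

/-- A function on the circle is measurable as soon as its composite with `θ ↦ ↑θ` is. -/
theorem AddCircle.measurable_of_measurable_comp_coe {B : Type*} [MeasurableSpace B]
    {g : AddCircle (2 * π) → B} (hg : Measurable fun θ : ℝ => g θ) : Measurable g := by
  have h := (hg.comp measurable_subtype_coe).comp (AddCircle.measurableEquivIco (2 * π) 0).measurable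
  convert h using 1
  funext x
  simp only [Function.comp_apply]
  congr 1
  exact (AddCircle.coe_equivIco).symm

/-- The same for functions of a circle point and a parameter. -/
theorem AddCircle.measurable_of_measurable_comp_coe_prod {B P : Type*} [MeasurableSpace B]
    [MeasurableSpace P] {g : AddCircle (2 * π) × P → B}
    (hg : Measurable fun w : ℝ × P => g (w.1, w.2)) : Measurable g := by
  have h := hg.comp (((measurable_subtype_coe.comp
    ((AddCircle.measurableEquivIco (2 * π) 0).measurable.comp measurable_fst))).prodMk measurable_snd)
  convert h using 1
  funext z
  simp only [Function.comp_apply]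
  congr 1
  exact Prod.ext (AddCircle.coe_equivIco).symm rfl

/-- **One U(1) link: the layer map has Jacobian `1 − C` for the Haar measure of the circle.**
For `Σ_j |c_j| < 1`, any `F : ℝ/2πℤ → ℝ/2πℤ` with `F ↑θ = ↑(θ + Σ_j c_j sin(α_j − θ))` and any
`J` with `J ↑θ = 1 − Σ_j c_j cos(α_j − θ)` satisfy `F_*(J · Haar) = Haar`, i.e. `HasJacobian volume F J`
— the hypothesis of `thmc_exact` / `thmc_hmc_exact` / `flow_reweighting_exact` for this link. -/
theorem hasJacobian_u1Layer_circle (hκ : ∑ j, |c j| < 1)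
    {F : AddCircle (2 * π) → AddCircle (2 * π)}
    (hF : ∀ θ : ℝ, F θ = ((θ + ∑ j, c j * sin (α j - θ) : ℝ) : AddCircle (2 * π)))
    {J : AddCircle (2 * π) → ℝ≥0∞}
    (hJ : ∀ θ : ℝ, J θ = ENNReal.ofReal (1 - ∑ j, c j * cos (α j - θ))) :
    HasJacobian (volume : Measure (AddCircle (2 * π))) F J := by
  have hFm : Measurable F := AddCircle.measurable_of_measurable_comp_coe (by
    simp_rw [hF]; exact measurable_coe_u1Layer c α)
  have hJm : Measurable J := AddCircle.measurable_of_measurable_comp_coe (by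
    simp_rw [hJ]; exact ENNReal.measurable_ofReal.comp (continuous_u1LayerJac c α).measurable)
  refine ⟨hFm, hJm, ?_⟩
  -- finite Borel measures on the circle are determined by bounded continuous test functions
  refine (ext_of_forall_lintegral_eq_of_IsFiniteMeasure fun f => ?_).symm
  have hfm : Measurable fun x : AddCircle (2 * π) => (f x : ℝ≥0∞) :=
    measurable_coe_nnreal_ennreal.comp f.continuous.measurable
  have hfFm : Measurable fun a : AddCircle (2 * π) => (f (F a) : ℝ≥0∞) := hfm.comp hFm
  rw [lintegral_map hfm hFm, lintegral_withDensity_eq_lintegral_mul _ hJm hfFm,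
    ← AddCircle.lintegral_preimage (2 * π) 0, ← AddCircle.lintegral_preimage (2 * π) 0]
  simp only [Pi.mul_apply, hF, hJ, zero_add]
  -- the real-valued test function on `ℝ`: continuous, `2π`-periodic, nonnegative
  set g : ℝ → ℝ := fun θ => (f (θ : AddCircle (2 * π)) : ℝ) with hg
  have hgc : Continuous g :=
    NNReal.continuous_coe.comp (f.continuous.comp (AddCircle.continuous_mk' (2 * π)))
  have hgp : Function.Periodic g (2 * π) := fun θ => by
    simp only [hg]
    rw [AddCircle.coe_add_period]
  have hg0 : ∀ θ, 0 ≤ g θ := fun θ => NNReal.coe_nonneg _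
  have hcoe : ∀ θ : ℝ, ((f (θ : AddCircle (2 * π)) : ℝ≥0) : ℝ≥0∞) = ENNReal.ofReal (g θ) :=
    fun θ => ENNReal.ofReal_coe_nnreal.symm
  have h2π : (0 : ℝ) ≤ 2 * π := by positivity
  -- left side: `∫⁻ f ↑θ = ofReal ∫ g`
  have lhs : ∫⁻ θ in Ioc (0 : ℝ) (2 * π), ((f (θ : AddCircle (2 * π)) : ℝ≥0) : ℝ≥0∞) =
      ENNReal.ofReal (∫ θ in (0 : ℝ)..2 * π, g θ) := by
    simp_rw [hcoe]
    rw [intervalIntegral.integral_of_le h2π,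
      ofReal_integral_eq_lintegral_ofReal hgc.integrableOn_Ioc (ae_of_all _ hg0)]
  -- right side: `∫⁻ (1 − C) · f ↑Φ = ofReal ∫ g(Φ θ)(1 − C θ) dθ`
  have hprod : Continuous fun θ : ℝ =>
      (1 - ∑ j, c j * cos (α j - θ)) * g (θ + ∑ j, c j * sin (α j - θ)) :=
    (continuous_u1LayerJac c α).mul (hgc.comp (continuous_u1Layer c α))
  have rhs : ∫⁻ θ in Ioc (0 : ℝ) (2 * π), ENNReal.ofReal (1 - ∑ j, c j * cos (α j - θ)) *
        ((f ((θ + ∑ j, c j * sin (α j - θ) : ℝ) : AddCircle (2 * π)) : ℝ≥0) : ℝ≥0∞) =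
      ENNReal.ofReal (∫ θ in (0 : ℝ)..2 * π,
        (1 - ∑ j, c j * cos (α j - θ)) * g (θ + ∑ j, c j * sin (α j - θ))) := by
    have hpt : ∀ θ : ℝ, ENNReal.ofReal (1 - ∑ j, c j * cos (α j - θ)) *
        ((f ((θ + ∑ j, c j * sin (α j - θ) : ℝ) : AddCircle (2 * π)) : ℝ≥0) : ℝ≥0∞) =
        ENNReal.ofReal ((1 - ∑ j, c j * cos (α j - θ)) * g (θ + ∑ j, c j * sin (α j - θ))) := by
      intro θ
      rw [hcoe, ← ENNReal.ofReal_mul (u1LayerJac_pos c α hκ θ).le]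
    simp_rw [hpt]
    rw [intervalIntegral.integral_of_le h2π, ofReal_integral_eq_lintegral_ofReal
      hprod.integrableOn_Ioc (ae_of_all _ fun θ =>
        mul_nonneg (u1LayerJac_pos c α hκ θ).le (hg0 _))]
  rw [lhs, rhs]
  congr 1
  have h := integral_comp_u1Layer_period c α 0 hgc hgp
  rw [zero_add] at h
  rw [← h]
  exact intervalIntegral.integral_congr fun θ _ => mul_comm _ _

/-- **One active link against any frozen environment.**  Passive data `p : P` (the other links),
with any s-finite law `ν`; measurable coefficient and angle maps `c(p)`, `α(p)` with
`Σ_j |c_j(p)| < 1`; then the update `(θ, p) ↦ (Φ_{c(p), α(p)} θ, p)` of (link × environment) has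
Jacobian `1 − C_{c(p), α(p)}(θ)` w.r.t. `Haar ⊗ ν`: `HasJacobian (volume.prod ν) … …`. -/
theorem hasJacobian_u1Layer_env {P : Type*} [MeasurableSpace P] {ν : Measure P} [SFinite ν]
    (cₚ αₚ : P → Fin n → ℝ) (hc : ∀ j, Measurable fun p => cₚ p j)
    (hα : ∀ j, Measurable fun p => αₚ p j) (hκ : ∀ p, ∑ j, |cₚ p j| < 1)
    {F : P → AddCircle (2 * π) → AddCircle (2 * π)}
    (hF : ∀ p (θ : ℝ), F p θ = ((θ + ∑ j, cₚ p j * sin (αₚ p j - θ) : ℝ) : AddCircle (2 * π)))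
    {J : P → AddCircle (2 * π) → ℝ≥0∞}
    (hJ : ∀ p (θ : ℝ), J p θ = ENNReal.ofReal (1 - ∑ j, cₚ p j * cos (αₚ p j - θ))) :
    HasJacobian ((volume : Measure (AddCircle (2 * π))).prod ν)
      (fun z => (F z.2 z.1, z.2)) fun z => J z.2 z.1 := by
  -- joint measurability of the representative formulas in `(θ, p)`
  have hΦ : Measurable fun w : ℝ × P => w.1 + ∑ j, cₚ w.2 j * sin (αₚ w.2 j - w.1) :=
    measurable_fst.add (Finset.measurable_sum _ fun j _ =>
      ((hc j).comp measurable_snd).mul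
        (measurable_sin.comp (((hα j).comp measurable_snd).sub measurable_fst)))
  have hC : Measurable fun w : ℝ × P => 1 - ∑ j, cₚ w.2 j * cos (αₚ w.2 j - w.1) :=
    measurable_const.sub (Finset.measurable_sum _ fun j _ =>
      ((hc j).comp measurable_snd).mul
        (measurable_cos.comp (((hα j).comp measurable_snd).sub measurable_fst)))
  refine HasJacobian.skewProd ?_ ?_ fun p => hasJacobian_u1Layer_circle (cₚ p) (αₚ p) (hκ p) (hF p) (hJ p)
  · refine AddCircle.measurable_of_measurable_comp_coe_prod ?_
    simp_rw [hF]
    exact AddCircle.measurable_mk'.comp hΦ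
  · refine AddCircle.measurable_of_measurable_comp_coe_prod ?_
    simp_rw [hJ]
    exact ENNReal.measurable_ofReal.comp hC

/-- **Summary for the engine.**  For every measurable frozen environment with contraction
indicator `< 1` there are a layer map and a Jacobian factor on (U(1) link) × (environment), given
on representatives by the engine's formulas, with `F_*(J · Haar ⊗ ν) = Haar ⊗ ν`. -/
theorem exists_hasJacobian_u1Layer_env {P : Type*} [MeasurableSpace P] (ν : Measure P) [SFinite ν]
    (cₚ αₚ : P → Fin n → ℝ) (hc : ∀ j, Measurable fun p => cₚ p j)
    (hα : ∀ j, Measurable fun p => αₚ p j) (hκ : ∀ p, ∑ j, |cₚ p j| < 1) :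
    ∃ (F : P → AddCircle (2 * π) → AddCircle (2 * π)) (J : P → AddCircle (2 * π) → ℝ≥0∞),
      (∀ p (θ : ℝ), F p θ = ((θ + ∑ j, cₚ p j * sin (αₚ p j - θ) : ℝ) : AddCircle (2 * π))) ∧
      (∀ p (θ : ℝ), J p θ = ENNReal.ofReal (1 - ∑ j, cₚ p j * cos (αₚ p j - θ))) ∧
      HasJacobian ((volume : Measure (AddCircle (2 * π))).prod ν)
        (fun z => (F z.2 z.1, z.2)) fun z => J z.2 z.1 := by
  obtain ⟨F, J, hF, hJ⟩ := exists_u1Layer_env (n := n) cₚ αₚ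
  exact ⟨F, J, hF, hJ, hasJacobian_u1Layer_env cₚ αₚ hc hα hκ hF hJ⟩

end Circle

end Summit.Ventures.LatticeQCDFlow.Exactness
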